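import Mathlib
import Summits.Ventures.PercRepro.TriangleCapTwoTrianglesTwoBelowB
import Summits.Ventures.PercRepro.TriangleCapTwoBelowAssembly

/-!
# PercRepro — TWO BELOW THE DIAGONAL IS EXACT ON THE `K₄⁻`-FREE CLASS FOR EVERY `k ≥ 27` (p3, gen 36; part 53)

* **`dense_stability_two_large`** — `K₄⁻`-free, `k ≥ 27`, `m ≥ 2k − 3`, not bipartite spanning with `≤ 1` missing
  cross pair ⇒ `Σ_v d(v)² + 2 (k − 3) ≤ m·k` — every case is now a theorem: triangle-free (TriangleCapTriangleFreeTwoB),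
  one triangle (TriangleCapOneTriangleTwoBelowB), two triangles (TriangleCapTwoTrianglesTwoBelowB), three or more
  (TriangleCapSubDiagonalTriangles);
* **`two_below_diagonal_exact_k4m_large`** — for `k ≥ 27`, `1 ≤ a`, `a + 2 ≤ k`, `m = a(k − a) − 2 ≥ 2k − 3` with
  `m`, `m + 1` not of the form `a′(k − a′)`: the maximum of `2·Σ_v C(d(v), 2)` over the `K₄⁻`-free graphs on `Fin k`
  with `m` edges IS `m (k − 2) − 2 (k − 3)`, attained by `K_{a, k−a}` minus two edges at one vertex — the
  sub-diagonal `r = 2` of the closed form P3-TRIANGLE-CAP.md §10av on the `K₄⁻`-free class, every `k ≥ 27`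
  (the range `8 ≤ k ≤ 26` stays on the census, exact at `k ≤ 10`).
Axioms: standard.
-/

namespace PercRepro

namespace TriangleCap

namespace C047

open Finset

variable {V : Type*} [Fintype V] [DecidableEq V]

/-- **TWO BELOW THE DIAGONAL, `K₄⁻`-FREE, `k ≥ 27`.** -/
theorem dense_stability_two_large (D : SimpleGraph V) [DecidableRel D.Adj] (hK : K4mFree D)
    (hk : 27 ≤ Fintype.card V) (hm : 2 * Fintype.card V ≤ D.edgeFinset.card + 3)
    (hnot : ¬ ∃ A : Finset V, (∀ x y, D.Adj x y → (x ∈ A ↔ y ∉ A)) ∧ (missing D A Aᶜ).card ≤ 1) :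
    ∑ v, deg D v * deg D v + 2 * (Fintype.card V - 3) ≤ D.edgeFinset.card * Fintype.card V :=
  dense_stability_two_modulo_two_triangles D hK (by omega) hm hnot
    (fun u v w a b c huv huw hvw hab hac hbc ha _ =>
      two_triangles_stability_two_large D hK hk hm huv huw hvw hab hac hbc ha)

/-- The cherry form. -/
theorem dense_stability_two_large_cherries (D : SimpleGraph V) [DecidableRel D.Adj] (hK : K4mFree D)
    (hk : 27 ≤ Fintype.card V) (hm : 2 * Fintype.card V ≤ D.edgeFinset.card + 3)
    (hnot : ¬ ∃ A : Finset V, (∀ x y, D.Adj x y → (x ∈ A ↔ y ∉ A)) ∧ (missing D A Aᶜ).card ≤ 1) :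
    2 * cherries D + 2 * D.edgeFinset.card + 2 * (Fintype.card V - 3) ≤
      D.edgeFinset.card * Fintype.card V := by
  have h1 := dense_stability_two_large D hK hk hm hnot
  have h2 := two_mul_cherries_add D
  have h3 := sum_deg_eq D
  omega

/-- `bipMinusStar n a r ≤ bip n a`. -/
theorem bipMinusStar_le_bip (n a r : ℕ) : bipMinusStar n a r ≤ bip n a := fun _ _ h => h.1

/-- `bipMinusStar n a r` is `K₄⁻`-free. -/
theorem k4mFree_bipMinusStar (n a r : ℕ) : K4mFree (bipMinusStar n a r) :=
  k4mFree_of_le _ _ (bipMinusStar_le_bip n a r) (k4mFree_bip n a)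

/-- **TWO BELOW THE DIAGONAL IS EXACT ON THE `K₄⁻`-FREE CLASS FOR EVERY `k ≥ 27`.** -/
theorem two_below_diagonal_exact_k4m_large (k a : ℕ) (hk : 27 ≤ k) (ha : 1 ≤ a) (hak : a + 2 ≤ k)
    (hdense : 2 * k ≤ a * (k - a) - 2 + 3)
    (hm : ∀ a', a' ≤ k → a * (k - a) - 2 ≠ a' * (k - a') ∧ a * (k - a) - 1 ≠ a' * (k - a')) :
    (∀ (D : SimpleGraph (Fin k)) [DecidableRel D.Adj], K4mFree D →
        D.edgeFinset.card = a * (k - a) - 2 →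
        2 * cherries D + 2 * (k - 3) ≤ (a * (k - a) - 2) * (k - 2)) ∧
      ∃ (D : SimpleGraph (Fin k)) (_ : DecidableRel D.Adj), K4mFree D ∧
        D.edgeFinset.card = a * (k - a) - 2 ∧ 2 * cherries D + 2 * (k - 3) = (a * (k - a) - 2) * (k - 2) := by
  have hka : 2 ≤ a * (k - a) := by
    obtain ⟨c, hc⟩ : ∃ c, k = a + 2 + c := ⟨k - a - 2, by omega⟩
    subst hc
    have : a + 2 + c - a = 2 + c := by omega
    rw [this]
    nlinarith
  obtain ⟨m, hmm⟩ : ∃ m, a * (k - a) = m + 2 := ⟨a * (k - a) - 2, by omega⟩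
  have e1 : a * (k - a) - 2 = m := by omega
  have e2 : a * (k - a) - 1 = m + 1 := by omega
  rw [e1] at hdense hm ⊢
  rw [e2] at hm
  constructor
  · intro D _ hK hD
    have hcard : Fintype.card (Fin k) = k := Fintype.card_fin k
    have hnot : ¬ ∃ A : Finset (Fin k), (∀ x y, D.Adj x y → (x ∈ A ↔ y ∉ A)) ∧ (missing D A Aᶜ).card ≤ 1 := by
      rintro ⟨A, hA, hN⟩
      have hNX := card_missing_add_card_edges D A hA
      have hXc : Aᶜ.card = k - A.card := by
        have := card_add_card_compl A
        rw [hcard] at this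
        omega
      have hXk : A.card ≤ k := by
        have := card_le_univ A
        rwa [hcard] at this
      obtain ⟨h1, h2⟩ := hm A.card hXk
      rw [hXc, hD] at hNX
      have : (missing D A Aᶜ).card = 0 ∨ (missing D A Aᶜ).card = 1 := by omega
      rcases this with h | h
      · rw [h] at hNX; exact h1 (by omega)
      · rw [h] at hNX; exact h2 (by omega)
    have := dense_stability_two_large_cherries D hK (by rw [hcard]; exact hk) (by rw [hcard, hD]; exact hdense) hnot
    rw [hcard, hD] at this
    obtain ⟨k', hk'⟩ : ∃ k', k = k' + 3 := ⟨k - 3, by omega⟩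
    subst hk'
    have e3 : k' + 3 - 3 = k' := by omega
    have e4 : k' + 3 - 2 = k' + 1 := by omega
    rw [e3] at this ⊢
    rw [e4]
    nlinarith
  · refine ⟨bipMinusStar k a 2, inferInstance, k4mFree_bipMinusStar k a 2, ?_, ?_⟩
    · have := card_edges_bipMinusStar k a 2 ha hak
      omega
    · have h := two_mul_cherries_bipMinusStar k a 2 ha hak (by omega)
      rw [hmm] at h
      obtain ⟨k', hk'⟩ : ∃ k', k = k' + 3 := ⟨k - 3, by omega⟩
      subst hk'
      have e3 : k' + 3 - 3 = k' := by omega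
      have e4 : k' + 3 - 2 = k' + 1 := by omega
      have e5 : 2 * (k' + 3) - 2 - 3 = 2 * k' + 1 := by omega
      rw [e4, e5] at h
      rw [e3, e4]
      nlinarith

/-- The cell `(27, 70)` on `K₄⁻`-free graphs: `2·cherries ≤ 1702`, attained (`K_{3,24}` minus two edges at a vertex). -/
theorem cell_twentyseven_seventy_k4m :
    (∀ (D : SimpleGraph (Fin 27)) [DecidableRel D.Adj], K4mFree D → D.edgeFinset.card = 70 →
      2 * cherries D ≤ 1702) ∧
    ∃ (D : SimpleGraph (Fin 27)) (_ : DecidableRel D.Adj), K4mFree D ∧ D.edgeFinset.card = 70 ∧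
      2 * cherries D = 1702 := by
  have h := two_below_diagonal_exact_k4m_large 27 3 (by norm_num) (by norm_num) (by norm_num) (by norm_num)
    (by decide)
  have e1 : 3 * (27 - 3) - 2 = 70 := by norm_num
  have e2 : (3 * (27 - 3) - 2) * (27 - 2) = 1750 := by norm_num
  have e3 : 2 * (27 - 3) = 48 := by norm_num
  rw [e1, e2, e3] at h
  obtain ⟨h1, D, inst, h2, h3, h4⟩ := h
  exact ⟨fun D _ hK hD => by have := h1 D hK hD; omega, D, inst, h2, h3, by omega⟩

/-- The cell `(28, 73)` on `K₄⁻`-free graphs: `2·cherries ≤ 1848`, attained. -/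
theorem cell_twentyeight_seventythree_k4m :
    (∀ (D : SimpleGraph (Fin 28)) [DecidableRel D.Adj], K4mFree D → D.edgeFinset.card = 73 →
      2 * cherries D ≤ 1848) ∧
    ∃ (D : SimpleGraph (Fin 28)) (_ : DecidableRel D.Adj), K4mFree D ∧ D.edgeFinset.card = 73 ∧
      2 * cherries D = 1848 := by
  have h := two_below_diagonal_exact_k4m_large 28 3 (by norm_num) (by norm_num) (by norm_num) (by norm_num)
    (by decide)
  have e1 : 3 * (28 - 3) - 2 = 73 := by norm_num
  have e2 : (3 * (28 - 3) - 2) * (28 - 2) = 1898 := by norm_num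
  have e3 : 2 * (28 - 3) = 50 := by norm_num
  rw [e1, e2, e3] at h
  obtain ⟨h1, D, inst, h2, h3, h4⟩ := h
  exact ⟨fun D _ hK hD => by have := h1 D hK hD; omega, D, inst, h2, h3, by omega⟩

end C047

end TriangleCap

end PercRepro
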